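import Summits.QuantumAdvantage.AdviceFreeQNC0.CubeTransfer
import Summits.QuantumAdvantage.AdviceFreeQNC0.LDMATransfer
import Literature.Computability.MetaComplexity.RobustHegedusLemma
import Summits.QuantumAdvantage.AdviceFreeQNC0.HammingLayerSums
import HarnessLib

/-!
# The `√n` FENCE of the atom method: `PLDAMSBool κ₀ D'` fails at degree `≥ C(κ₀)·√n`
# (planner qa-qnc0-p1 ROUND-10 §4, ask P14; Sketch11 §23.5b `NotPLDAMSAboveSqrtLog` VERBATIM)

Cell qa-qnc0 (route `QuantumAdvantage/RingFrame`, crux α = stmt-QuantumAdvantage-19119), seat qa-qnc0-lit gen 10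
(idle-time kernel item).  Companion of `pldamsBool_sqrt` (`LDMATransfer.lean`: PLDAMS HOLDS at degree `⌊c√n⌋`):
here PLDAMS FAILS at degree `C·√n`, so every argument of the cell that ends in class balance on atoms cut out by
polynomials of total degree `d` (LevelSet, THEOREMS U/V, T9, `ldma_of_pldams_fibres`) stops at `d ≍ √L`
(ROUND-10 §4 "FENCE").

## Statement and HONEST NOTE on its strength

`NotPLDAMSAboveSqrtLog` (verbatim): `∀ κ₀ > 0, ∃ C > 0, ∀ D', (eventually C·√(n·(1 + log(1/κ₀))) ≤ D' n) →
¬ PLDAMSBool κ₀ D'`.  As typed, `C` is chosen AFTER `κ₀`, so the factor `√(1 + log(1/κ₀))` is immaterial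
(`≥ 1` for `κ₀ ≤ 1`) and a certificate at degree `C(κ₀)·√n` with `C(κ₀) = 16/√κ₀` suffices; accordingly the
proof below uses CHEBYSHEV (the binomial variance `Σ_s C(n,s)(2s−n)² = n·2^n`, the cell's
`sum_choose_mul_sq` of `HammingLayerSums.lean`) for the weight window, not Hoeffding.  The sharper fence of ROUND-10 §4
— ONE absolute `C` for all `κ₀`, degree `√(2n·ln(4/κ₀))` — is TRUE (same certificate, exponential tail via
Hoeffding / `vanLint_sum_choose_le_exp_binEntropy`) but is NOT the typed statement and is not proved here.

## The certificate (ROUND-10 §4, Lucas periodicity)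

For `κ₀ ≤ 1` and `n` large let `P = 2^ℓ` be the largest power of two `≤ min(D' n, n−1) + 1`, `a = (n−P)/2`,
and `f(u) = 1[wt u ≡ w (mod P) for some w ∈ [a, a+P) with 3 ∣ w]` — a sum of the tree's Lucas polynomials
`Hegedus.lucasPoly 𝔽₂ n 2 ℓ w` (`RobustHegedusLemma.lean`: `= 1[wt ≡ w mod 2^ℓ]`, degree `≤ 2^ℓ − 1 ≤ D' n`).
On the window `wt u ∈ [a, a+P)` it equals `1[3 ∣ wt u]`, so `supp f ∩ cls 1 ⊆ {wt ∉ window}` and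
`cls 0 ∩ {wt ∈ window} ⊆ supp f`; Chebyshev gives `#{wt ∉ window}·(P−1)² ≤ n·2^n ≤ (κ₀/16)·2^n·(P−1)²`
(`P − 1 ≥ 4√(n/κ₀)`; `sum_choose_mul_sq`, `Hegedus.card_layer`), and `#cls 0 ≥ (2^n − 2)/3` (`three_mul_card_cls_ge`); PLDAMS at `r = 1` would give
`κ₀·(3/16)·2^n ≤ κ₀·#supp f ≤ #(supp f ∩ cls 1) ≤ (κ₀/16)·2^n`, absurd.  For `κ₀ > 1` the constant function
`true` refutes PLDAMS at any degree.

## Contents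

* `NotPLDAMSAboveSqrtLog` — Sketch11 §23.5b verbatim;  `not_pldams_above_sqrt_log : NotPLDAMSAboveSqrtLog` — PROVED.
* `PLDAMSFence.sum_sq_wt` (`Σ_u (n − 2·wt u)² = n·2^n`, from `sum_choose_mul_sq`), `PLDAMSFence.card_mul_le_of_far`
  (Chebyshev count),
  `PLDAMSFence.fenceFn` and its window / degree lemmas.

WHAT THIS IS NOT: nothing about α; the `log(1/κ₀)`-sharp absolute-constant fence is not proved (see above).
-/

namespace Summit.QuantumAdvantage.AdviceFreeQNC0

open Finset
open Literature.Computability.MetaComplexity Literature.Computability.MetaComplexity.Smolensky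

/-- **FENCE CERTIFICATE (target `not_pldams_above_sqrt_log`)**, planner qa-qnc0-p1 Sketch11 §23.5b VERBATIM:
`PLDAMSBool κ₀ D'` fails whenever `D' n ≥ C·√(n·(1 + log(1/κ₀)))` eventually. -/
def NotPLDAMSAboveSqrtLog : Prop :=
  ∀ κ₀ : ℝ, 0 < κ₀ → ∃ C : ℝ, 0 < C ∧ ∀ D' : ℕ → ℕ,
    (∃ n₁ : ℕ, ∀ n ≥ n₁, C * Real.sqrt (n * (1 + Real.log (1 / κ₀))) ≤ (D' n : ℝ)) →
    ¬ PLDAMSBool κ₀ D'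

namespace PLDAMSFence

variable {n : ℕ}

/-! ### Chebyshev on the cube -/

/-- **Binomial variance on the cube**: `Σ_u (n − 2·wt u)² = n·2^n`. -/
theorem sum_sq_wt (n : ℕ) : ∑ u : Fin n → Bool, ((n : ℝ) - 2 * (wt u : ℝ)) ^ 2 = (n : ℝ) * 2 ^ n := by
  have hmaps : ∀ u ∈ (univ : Finset (Fin n → Bool)), wt u ∈ range (n + 1) :=
    fun u _ => mem_range.2 (Nat.lt_succ_of_le (wt_le_dim u))
  rw [← sum_fiberwise_of_maps_to hmaps, ← sum_choose_mul_sq n]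
  refine sum_congr rfl fun s _ => ?_
  have hfib : ∀ u ∈ univ.filter (fun u : Fin n → Bool => wt u = s),
      ((n : ℝ) - 2 * (wt u : ℝ)) ^ 2 = ((2 * s : ℝ) - n) ^ 2 := fun u hu => by
    rw [(mem_filter.1 hu).2]; ring
  rw [sum_congr rfl hfib, sum_const, nsmul_eq_mul]
  congr 1
  exact_mod_cast Hegedus.card_layer n s

/-- **Chebyshev count**: a set of points all of whose weights satisfy `(n − 2·wt)² ≥ T` has
`#S · T ≤ n·2^n`. -/
theorem card_mul_le_of_far (T : ℝ) (S : Finset (Fin n → Bool))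
    (hS : ∀ u ∈ S, T ≤ ((n : ℝ) - 2 * (wt u : ℝ)) ^ 2) : (S.card : ℝ) * T ≤ (n : ℝ) * 2 ^ n := by
  calc (S.card : ℝ) * T = ∑ _u ∈ S, T := by rw [sum_const, nsmul_eq_mul]
    _ ≤ ∑ u ∈ S, ((n : ℝ) - 2 * (wt u : ℝ)) ^ 2 := sum_le_sum hS
    _ ≤ ∑ u, ((n : ℝ) - 2 * (wt u : ℝ)) ^ 2 :=
        sum_le_sum_of_subset_of_nonneg (subset_univ S) fun _ _ _ => sq_nonneg _
    _ = (n : ℝ) * 2 ^ n := sum_sq_wt n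

/-- Weights outside the window `[a, a+P)` with `a = (n−P)/2`, `P ≤ n`, are far from `n/2`:
`(n − 2s)² ≥ (P − 1)²`. -/
theorem sq_ge_of_not_mem_window {P s : ℕ} (hP1 : 1 ≤ P) (hP : P ≤ n)
    (hs : s ∉ Ico ((n - P) / 2) ((n - P) / 2 + P)) :
    ((P : ℝ) - 1) ^ 2 ≤ ((n : ℝ) - 2 * s) ^ 2 := by
  rw [mem_Ico, not_and_or, not_le, not_lt] at hs
  have h2a : 2 * ((n - P) / 2) ≤ n - P := Nat.mul_div_le (n - P) 2
  have h2a' : n - P - 1 ≤ 2 * ((n - P) / 2) := by omega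
  have h0 : (0 : ℝ) ≤ (P : ℝ) - 1 := by
    have : (1 : ℝ) ≤ P := by exact_mod_cast hP1
    linarith
  rcases hs with h | h
  · -- `s < a`: `n − 2s ≥ P`
    have h1 : (P : ℝ) ≤ (n : ℝ) - 2 * s := by
      have : P + 2 * s ≤ n := by omega
      have : ((P + 2 * s : ℕ) : ℝ) ≤ n := by exact_mod_cast this
      push_cast at this; linarith
    exact pow_le_pow_left₀ h0 (by linarith) 2
  · -- `s ≥ a + P`: `2s − n ≥ P − 1`
    have h1 : (P : ℝ) - 1 ≤ 2 * (s : ℝ) - n := by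
      have : n + P ≤ 2 * s + 1 := by omega
      have : ((n + P : ℕ) : ℝ) ≤ ((2 * s + 1 : ℕ) : ℝ) := by exact_mod_cast this
      push_cast at this; linarith
    rw [show ((n : ℝ) - 2 * s) ^ 2 = (2 * (s : ℝ) - n) ^ 2 by ring]
    exact pow_le_pow_left₀ h0 h1 2

/-! ### The Lucas-periodic window approximator of `1[3 ∣ wt]` -/

/-- The fence function as an `𝔽₂`-valued function: the sum of the Lucas polynomials `1[wt ≡ w (mod 2^ℓ)]`
over the multiples of `3` in the weight window `[a, a + 2^ℓ)`. -/
noncomputable def fenceFn (n ℓ a : ℕ) : CubeFn (ZMod 2) n :=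
  ∑ w ∈ (Ico a (a + 2 ^ ℓ)).filter (fun w => w % 3 = 0), Hegedus.lucasPoly (ZMod 2) n 2 ℓ w

/-- The fence function has degree `≤ 2^ℓ − 1`. -/
theorem fenceFn_mem_lowDeg (n ℓ a : ℕ) : fenceFn n ℓ a ∈ lowDeg (ZMod 2) n (2 ^ ℓ - 1) := by
  unfold fenceFn
  exact Submodule.sum_mem _ fun w _ => Hegedus.lucasPoly_mem_lowDeg (F := ZMod 2) 2 ℓ w

/-- Two members of a window of length `P` with the same residue mod `P` are equal. -/
theorem eq_of_mod_eq_of_mem_window {P a x y : ℕ} (hx : x ∈ Ico a (a + P)) (hy : y ∈ Ico a (a + P))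
    (h : x % P = y % P) : x = y := by
  rw [mem_Ico] at hx hy
  have key : ∀ x y : ℕ, a ≤ y → x < a + P → x % P = y % P → y ≤ x → x = y := by
    intro x y hy hx hxy hyx
    have hd : P ∣ x - y := (Nat.modEq_iff_dvd' hyx).1 hxy.symm
    obtain ⟨c, hc⟩ := hd
    have hlt : x - y < P := by omega
    rcases Nat.eq_zero_or_pos c with h0 | hpos
    · rw [h0, mul_zero] at hc
      omega
    · have : P ≤ x - y := by rw [hc]; exact Nat.le_mul_of_pos_right P hpos
      omega
  rcases le_total y x with hyx | hxy
  · exact key x y hy.1 hx.2 h hyx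
  · exact (key y x hx.1 hy.2 h.symm hxy).symm

/-- On the window the fence function is the indicator of `3 ∣ wt`. -/
theorem fenceFn_apply_of_mem_window {ℓ a : ℕ} {u : Fin n → Bool} (hu : wt u ∈ Ico a (a + 2 ^ ℓ)) :
    fenceFn n ℓ a u = if wt u % 3 = 0 then 1 else 0 := by
  unfold fenceFn
  rw [Finset.sum_apply]
  have hterm : ∀ w ∈ (Ico a (a + 2 ^ ℓ)).filter (fun w => w % 3 = 0),
      Hegedus.lucasPoly (ZMod 2) n 2 ℓ w u = if wt u = w then 1 else 0 := by
    intro w hw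
    rw [Hegedus.lucasPoly_apply (F := ZMod 2) 2]
    change (if wt u % 2 ^ ℓ = w % 2 ^ ℓ then (1 : ZMod 2) else 0) = _
    have hwI := (mem_filter.1 hw).1
    by_cases h : wt u = w
    · rw [if_pos h, if_pos (by rw [h])]
    · rw [if_neg h, if_neg (fun h' => h (eq_of_mod_eq_of_mem_window hu hwI h'))]
  rw [sum_congr rfl hterm, sum_ite_eq]
  by_cases h3 : wt u % 3 = 0
  · rw [if_pos (mem_filter.2 ⟨hu, h3⟩), if_pos h3]
  · have hnot : wt u ∉ (Ico a (a + 2 ^ ℓ)).filter (fun w => w % 3 = 0) := fun h => h3 (mem_filter.1 h).2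
    rw [if_neg hnot, if_neg h3]

/-- The Boolean fence function `f(u) = [fenceFn u = 1]` has degree `≤ d` whenever `2^ℓ − 1 ≤ d`. -/
theorem hasDeg_fence {ℓ a d : ℕ} (hd : 2 ^ ℓ - 1 ≤ d) :
    HasDeg (fun u : Fin n → Bool => decide (fenceFn n ℓ a u = 1)) d := by
  unfold HasDeg
  have key : (fun u : Fin n → Bool => if decide (fenceFn n ℓ a u = 1) = true then (1 : ZMod 2) else 0) =
      fenceFn n ℓ a := by
    funext u
    have h01 : ∀ z : ZMod 2, z = 0 ∨ z = 1 := by decide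
    rcases h01 (fenceFn n ℓ a u) with h | h
    · rw [h]; decide
    · rw [h]; decide
  rw [key]
  exact lowDeg_mono hd (fenceFn_mem_lowDeg n ℓ a)

end PLDAMSFence

open PLDAMSFence in
/-- **The `√n` fence of the atom method — PROVED** (Sketch11 §23.5b verbatim): for every `κ₀ > 0` there is
`C > 0` such that `PLDAMSBool κ₀ D'` fails for every degree profile with `D' n ≥ C·√(n(1 + log(1/κ₀)))`
eventually.  (`C = 16/√κ₀` for `κ₀ ≤ 1`; see the file header for why the typed statement does not need the
`log`-sharp absolute constant.) -/
theorem not_pldams_above_sqrt_log : NotPLDAMSAboveSqrtLog := by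
  intro κ₀ hκ₀
  by_cases hκ1 : 1 < κ₀
  · -- `κ₀ > 1`: the constant function refutes PLDAMS at any degree
    refine ⟨1, one_pos, fun D' _ hP => ?_⟩
    obtain ⟨n₀, hP⟩ := hP
    have h := hP n₀ le_rfl (fun _ => true) (hasDeg_const true _) 0
    have hsupp : (univ.filter fun u : Fin n₀ → Bool => true = true).card = 2 ^ n₀ := by
      rw [filter_true_of_mem fun _ _ => rfl, card_univ, Fintype.card_fun, Fintype.card_bool, Fintype.card_fin]
    have hle : ((univ.filter fun u : Fin n₀ → Bool => true = true ∧ wt u % 3 = 0 % 3).card : ℝ) ≤ 2 ^ n₀ := by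
      have : (univ.filter fun u : Fin n₀ → Bool => true = true ∧ wt u % 3 = 0 % 3).card ≤ 2 ^ n₀ :=
        (card_filter_le _ _).trans_eq (by rw [card_univ, Fintype.card_fun, Fintype.card_bool, Fintype.card_fin])
      exact_mod_cast this
    rw [hsupp] at h
    push_cast at h
    have h2 : (0 : ℝ) < 2 ^ n₀ := by positivity
    nlinarith
  · -- `κ₀ ≤ 1`
    push Not at hκ1
    refine ⟨16 / Real.sqrt κ₀, by positivity, fun D' hD' hP => ?_⟩
    obtain ⟨n₁, hn₁⟩ := hD'
    obtain ⟨n₀, hP⟩ := hP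
    -- a large `n`
    obtain ⟨n, hn⟩ : ∃ n : ℕ, n = max n₀ (max n₁ (⌈256 / κ₀⌉₊ + 3)) := ⟨_, rfl⟩
    have hn0 : n₀ ≤ n := hn ▸ le_max_left _ _
    have hn1 : n₁ ≤ n := hn ▸ (le_max_left _ _).trans (le_max_right _ _)
    have hn2 : ⌈256 / κ₀⌉₊ + 3 ≤ n := hn ▸ (le_max_right _ _).trans (le_max_right _ _)
    have hn3 : 3 ≤ n := le_trans (Nat.le_add_left 3 _) hn2
    have hnκ : 256 / κ₀ ≤ (n : ℝ) := by
      have h1 : 256 / κ₀ ≤ (⌈256 / κ₀⌉₊ : ℝ) := Nat.le_ceil _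
      have h2 : ((⌈256 / κ₀⌉₊ + 3 : ℕ) : ℝ) ≤ n := by exact_mod_cast hn2
      push_cast at h2; linarith
    have hnpos : (0 : ℝ) < n := by exact_mod_cast (show 0 < n by omega)
    have hn256 : (256 : ℝ) ≤ n := le_trans (by rw [le_div_iff₀ hκ₀]; nlinarith) hnκ
    -- the degree bound at `n`
    have hDn : 16 / Real.sqrt κ₀ * Real.sqrt (n * (1 + Real.log (1 / κ₀))) ≤ (D' n : ℝ) := hn₁ n hn1
    have hsqrtκ : 0 < Real.sqrt κ₀ := Real.sqrt_pos.2 hκ₀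
    have hlog : 0 ≤ Real.log (1 / κ₀) := Real.log_nonneg (by rw [le_div_iff₀ hκ₀]; linarith)
    have hDn' : 16 * Real.sqrt (n / κ₀) ≤ (D' n : ℝ) := by
      have h1 : Real.sqrt (n : ℝ) ≤ Real.sqrt (n * (1 + Real.log (1 / κ₀))) :=
        Real.sqrt_le_sqrt (by nlinarith)
      have h2 : Real.sqrt (n / κ₀) = Real.sqrt n / Real.sqrt κ₀ := by
        rw [Real.sqrt_div' _ hκ₀.le]
      rw [h2]
      calc 16 * (Real.sqrt n / Real.sqrt κ₀) = 16 / Real.sqrt κ₀ * Real.sqrt n := by ring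
        _ ≤ 16 / Real.sqrt κ₀ * Real.sqrt (n * (1 + Real.log (1 / κ₀))) :=
            mul_le_mul_of_nonneg_left h1 (by positivity)
        _ ≤ D' n := hDn
    -- `m = min (D' n) (n-1) ≥ 8 √(n/κ₀)`
    obtain ⟨m, hm⟩ : ∃ m : ℕ, m = min (D' n) (n - 1) := ⟨_, rfl⟩
    have hmD : m ≤ D' n := hm ▸ min_le_left _ _
    have hmn : m ≤ n - 1 := hm ▸ min_le_right _ _
    have hsq_nκ : Real.sqrt (n / κ₀) ^ 2 = n / κ₀ := Real.sq_sqrt (by positivity)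
    have hsqrt_le : 8 * Real.sqrt (n / κ₀) ≤ (n : ℝ) - 1 := by
      -- `64 n/κ₀ ≤ n²/4 ≤ (n-1)²` from `n ≥ 256/κ₀`
      have h64 : 64 * (n / κ₀) ≤ ((n : ℝ) - 1) ^ 2 := by
        have : (n : ℝ) / κ₀ * 256 ≤ (n : ℝ) * n := by
          rw [div_mul_eq_mul_div, div_le_iff₀ hκ₀]
          have : 256 ≤ (n : ℝ) * κ₀ := by rwa [div_le_iff₀ hκ₀] at hnκ
          nlinarith
        nlinarith
      have hpos : 0 ≤ (n : ℝ) - 1 := by linarith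
      nlinarith [Real.sqrt_nonneg (n / κ₀), sq_nonneg (8 * Real.sqrt (n / κ₀) - ((n : ℝ) - 1))]
    have hm_ge : 8 * Real.sqrt (n / κ₀) ≤ (m : ℝ) := by
      rw [hm, Nat.cast_min, Nat.cast_sub (by omega), Nat.cast_one]
      exact le_min (by linarith) hsqrt_le
    -- `P = 2^ℓ ≤ m + 1 ≤ n`, `2 (P - 1) ≥ m`
    obtain ⟨ℓ, hℓ⟩ : ∃ ℓ : ℕ, ℓ = Nat.log 2 (m + 1) := ⟨_, rfl⟩
    obtain ⟨P, hPdef⟩ : ∃ P : ℕ, P = 2 ^ ℓ := ⟨_, rfl⟩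
    have hPle : P ≤ m + 1 := by
      rw [hPdef, hℓ]; exact Nat.pow_log_le_self 2 (Nat.succ_ne_zero m)
    have hPgt : m + 1 < 2 * P := by
      have := Nat.lt_pow_succ_log_self (b := 2) Nat.one_lt_two (m + 1)
      rw [pow_succ, ← hℓ, ← hPdef] at this
      omega
    have hP1 : 1 ≤ P := by rw [hPdef]; exact Nat.one_le_two_pow
    have hPn : P ≤ n := by omega
    have hPD : P - 1 ≤ D' n := by omega
    have hℓD : 2 ^ ℓ - 1 ≤ D' n := by rw [← hPdef]; exact hPD
    have hP4 : 4 * Real.sqrt (n / κ₀) ≤ (P : ℝ) - 1 := by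
      have : (m : ℝ) ≤ 2 * ((P : ℝ) - 1) := by
        have : m ≤ 2 * (P - 1) := by omega
        have h' : ((m : ℕ) : ℝ) ≤ ((2 * (P - 1) : ℕ) : ℝ) := by exact_mod_cast this
        rw [Nat.cast_mul, Nat.cast_sub hP1, Nat.cast_ofNat, Nat.cast_one] at h'
        exact h'
      linarith
    have hT : 16 * (n / κ₀) ≤ ((P : ℝ) - 1) ^ 2 := by
      nlinarith [Real.sqrt_nonneg (n / κ₀)]
    have hTpos : 0 < ((P : ℝ) - 1) ^ 2 := lt_of_lt_of_le (by positivity) hT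
    -- the window and the far set
    obtain ⟨a, ha⟩ : ∃ a : ℕ, a = (n - P) / 2 := ⟨_, rfl⟩
    set FAR : Finset (Fin n → Bool) := univ.filter fun u => wt u ∉ Ico a (a + P) with hFAR
    have hFARcard : (FAR.card : ℝ) ≤ κ₀ / 16 * 2 ^ n := by
      have h1 : (FAR.card : ℝ) * ((P : ℝ) - 1) ^ 2 ≤ n * 2 ^ n :=
        card_mul_le_of_far _ FAR fun u hu =>
          sq_ge_of_not_mem_window hP1 hPn (by rw [← ha]; exact (mem_filter.1 hu).2)
      have h2 : (n : ℝ) * 2 ^ n ≤ κ₀ / 16 * 2 ^ n * ((P : ℝ) - 1) ^ 2 := by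
        have : (n : ℝ) ≤ κ₀ / 16 * ((P : ℝ) - 1) ^ 2 := by
          have : (n : ℝ) = κ₀ / 16 * (16 * (n / κ₀)) := by field_simp
          rw [this]; exact mul_le_mul_of_nonneg_left hT (by positivity)
        nlinarith [pow_pos (show (0:ℝ) < 2 by norm_num) n]
      exact le_of_mul_le_mul_right (h1.trans h2) hTpos
    -- the fence function at `n`
    set f : (Fin n → Bool) → Bool := fun u => decide (fenceFn n ℓ a u = 1) with hf
    have hfdeg : HasDeg f (D' n) := hasDeg_fence hℓD
    have h := hP n hn0 f hfdeg 1
    -- (i) `supp f ∩ cls 1 ⊆ FAR`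
    have hnum : ((univ.filter fun u : Fin n → Bool => f u = true ∧ wt u % 3 = 1 % 3).card : ℝ) ≤ FAR.card := by
      have : (univ.filter fun u : Fin n → Bool => f u = true ∧ wt u % 3 = 1 % 3) ⊆ FAR := by
        intro u hu
        obtain ⟨hfu, hwu⟩ := (mem_filter.1 hu).2
        refine mem_filter.2 ⟨mem_univ _, fun hwin => ?_⟩
        have hwin' : wt u ∈ Ico a (a + 2 ^ ℓ) := by rw [← hPdef]; exact hwin
        have hval := fenceFn_apply_of_mem_window hwin'
        have h1 : fenceFn n ℓ a u = 1 := of_decide_eq_true hfu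
        rw [h1] at hval
        by_cases h3 : wt u % 3 = 0
        · omega
        · rw [if_neg h3] at hval; exact one_ne_zero hval
      exact_mod_cast card_le_card this
    -- (ii) `cls 0 \ FAR ⊆ supp f`
    have hden : ((cls n 0).card : ℝ) - FAR.card ≤ (univ.filter fun u : Fin n → Bool => f u = true).card := by
      have hsub : cls n 0 \ FAR ⊆ univ.filter fun u : Fin n → Bool => f u = true := by
        intro u hu
        rw [mem_sdiff] at hu
        have hcls : wt u % 3 = 0 := by simpa [cls] using hu.1
        have hwin : wt u ∈ Ico a (a + P) := by
          by_contra hnot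
          exact hu.2 (mem_filter.2 ⟨mem_univ _, hnot⟩)
        refine mem_filter.2 ⟨mem_univ _, ?_⟩
        have hwin' : wt u ∈ Ico a (a + 2 ^ ℓ) := by rw [← hPdef]; exact hwin
        have hval := fenceFn_apply_of_mem_window hwin'
        rw [if_pos hcls] at hval
        exact decide_eq_true hval
      have h1 := card_le_card hsub
      have h2 := le_card_sdiff FAR (cls n 0)   -- #cls − #FAR ≤ #(cls \ FAR)
      have : ((cls n 0).card : ℝ) - FAR.card ≤ ((cls n 0 \ FAR).card : ℝ) := by
        have : (cls n 0).card - FAR.card ≤ (cls n 0 \ FAR).card := h2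
        rw [sub_le_iff_le_add]
        exact_mod_cast (Nat.sub_le_iff_le_add.1 this)
      exact this.trans (by exact_mod_cast h1)
    -- (iii) `#cls 0 ≥ 2^n / 4`
    have hcls : (2 : ℝ) ^ n / 4 ≤ (cls n 0).card := by
      have h1 := three_mul_card_cls_ge n 0
      have h8 : (8 : ℝ) ≤ 2 ^ n := by
        calc (8 : ℝ) = 2 ^ 3 := by norm_num
          _ ≤ 2 ^ n := pow_le_pow_right₀ (by norm_num) hn3
      linarith
    -- contradiction
    have h2n : (0 : ℝ) < 2 ^ n := by positivity
    nlinarith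
end Summit.QuantumAdvantage.AdviceFreeQNC0
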